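import Literature.MathematicalPhysics.QuantumLattice.HubbardNNRepulsionInteraction
import Literature.MathematicalPhysics.QuantumLattice.HubbardTTPrimeTorusLimitState
import HarnessLib

/-!
# The `V`-direction BOX → WORD rules for the extended `t–t'–U–V` Hubbard model at fixed filling:
# U-only floors hold for the `U–V` model, caps = U-only cap + `V` × a nearest-neighbour word,
# `(U,V)`-boxes, the joint tangent plane at a U-only anchor, Lipschitz continuity in `V`

Topic `Literature/MathematicalPhysics/QuantumLattice` (family `hubbard`). Companion of
`HubbardNNRepulsionInteraction.lean` (`nnRepulsionFermionInteraction`, the extended interaction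
`hubbardTT'VFermionInteraction t t' U V = Φ(t,t',U) + V·Φ_1`, its conjugate density
`W(ω) = e_{Φ_1}(ω) ≥ 0`, `W ≤ 2(ρ + 2D)` / `≤ 4ρ` on translation-invariant states of `ℤ²`), of
`HubbardTTPrimeTPPFillingTransport.lean` (pencil transport over a state class: concavity, signed floors,
signed caps, class Lipschitz) and of `TIGroundEnergyDensityCouplingFamilies.lean` (the fixed-filling
variational density `tiGroundEnergyDensityAt Ψ 1 ρ` and its bridge to the certified `t–t'` energy density
`energyDensityTT'`). Written for the material-oracle stage S1/S2 seam (cell `pub/hubbard-downfold`, seat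
unc-1 = the interaction direction): the printed practice «absorb the cRPA nearest-neighbour `V` into an
effective `U⋆ = U − V̄`» (Schüler et al. 2013: the Peierls–Feynman–Bogoliubov OPTIMAL local model;
finite-matrix kernel face `OptimalLocalHubbardMapping.lean`, `PFB.groundEnergy_ext_mem_Icc`:
`E₀(T + U·D) ≤ E₀(T + U·D + V̂) ≤ E₀(T + U·D) + ω_{T+U·D}(V̂)` for `V̂ ⪰ 0`) is a variational heuristic;
what it gives RIGOROUSLY, per unit volume and at fixed filling `0 < ρ < 2`, for
`e_ρ(t,t',U,V) := tiGroundEnergyDensityAt (hubbardTT'VFermionInteraction t t' U V) 1 ρ` (at `V = 0` this IS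
`energyDensityTT' t t' U ρ`, `tiGroundEnergyDensityAt_hubbardTT'V_zero`), is:

* CONCAVE AND NON-DECREASING IN `V` (`concaveOn_…_V`, `…_mono_V`: `W ≥ 0` on every state) and
  NON-DECREASING IN `U` (`…_mono_U`: `D ≥ 0`).
* **FLOORS TRANSFER FOR FREE**: `energyDensityTT' t t' U ρ ≤ e_ρ(t,t',U,V)` for `V ≥ 0`, so a certified
  U-only floor `L` is a floor of the extended model (`energyDensityTT'_floor_le_hubbardTT'V` — the
  infinite-volume face of `PFB.groundEnergy_loc_le_ext`); signed form `L + min(0, 4ρV) ≤ e_ρ` for any sign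
  of `V` (`energyDensityTT'_floor_add_min_le_hubbardTT'V`).
* **CAPS = U-ONLY CAP + `V` × A NEAREST-NEIGHBOUR WORD** (the face of `PFB.groundEnergy_ext_mem_Icc`; a
  torus-limit `t–t'` ground state attaining `energyDensityTT'` is the trial state): with a word `W ≤ Whi`
  valid for the torus-limit ground states at `(t,t',U,ρ)` — the hypothesis class of every certified row —
  `e_ρ(t,t',U,V) ≤ energyDensityTT' t t' U ρ + V·Whi` (`hubbardTT'V_le_energyDensityTT'_add_of_nnWord`; the
  explicit-correlator edition `_of_nnCorrWord` takes `Σ_i Re ω(n_0 n_{e_i}) ≤ Whi` as a certificate engine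
  prints it); with a DOCC ceiling `D ≤ dhi` of the same class, `… + V·2(ρ + 2dhi)` (`_of_doccWord`); with
  no word at all, `… + V·(2ρ + ρ²)` (`_kinematic`, `U > 0`: `D ≤ (ρ/2)²`); each also under a certified
  U-only cap `R` (`hubbardTT'V_le_cap_add_…`).
* the TWO-SIDED WINDOWS `e_ρ ∈ [L, R + V·(word)]` (`tiGroundEnergyDensityAt_hubbardTT'V_mem_Icc_…`) and
  the **`(U,V)`-BOX EDITION** on `[U₁,U₂] × [V₁,V₂]` — floor at the left `U`-end, cap at the right `U`-end
  plus `V₂ ×` a word at the right end (`…_mem_Icc_on_box[_of_doccWord|_kinematic]`): ONE statement per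
  cell, the shape a box engine consumes;
* the **JOINT TANGENT PLANE AT A U-ONLY ANCHOR `(Ũ, 0)`** — Schüler's functional `Φ̃(Ũ)` per site:
  `e_ρ(U,V) ≤ e(t,t',Ũ,ρ) + max((U−Ũ)dlo, (U−Ũ)dhi) + V·Whi` from docc and nearest-neighbour words at `Ũ`
  (`hubbardTT'V_le_anchor_tangentPlane`): the local model at ANY `Ũ`, in particular at `U⋆ < U`, CAPS the
  extended one, and no choice of `Ũ` floors it above `e(t,t',U,ρ)`;
* the increment bracket `0 ≤ e_ρ(V₂) − e_ρ(V₁) ≤ 4ρ(V₂ − V₁)` and `|e_ρ(V) − e_ρ(V')| ≤ 4ρ|V − V'|`.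

HONEST SCOPE (numbers, not adjectives). The enclosure is `[e_U, e_U + V·W⁺]` per site; at a cuprate
filling `ρ = 0.85` and `V = 0.2U = 1.6t` its `V`-width is `V·W⁺ ≈ 1.6 × 2(0.85 + 2·0.05) ≈ 3.0t` with a
docc word `0.05`, `≈ 2.3t` at the Hartree level `W ≈ 2ρ²` a certified nearest-neighbour word would give,
against `|e| ≈ 0.9t`: the `V` coordinate of a one-band box is NOT absorbable into a certified U-only
ENERGY word at screening resolution, and NO order / correlator word of the U-only model transports to the
`U–V` model this way (an energy-window relaxation at excess `V·W⁺` above the ground energy is vacuous).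
The certified route for `V` is production on `H(t,t',U,V)` itself — whose interaction object the
companion file supplies — not transport; «`U⋆ = U − V`» remains a modelling choice (EXTRAPOLATED), which is
the kernel's verdict for the router's V-absorption rule. Everything here is PROVED; no definition, no
named fact, no number of record, no `sorry`; `e_ρ` is the translation-invariant fixed-filling variational
density — identified with a torus thermodynamic limit at `V = 0` only.

## Mathlib / tree search

REUSED (cited, not restated): `FermionInteraction.concaveOn_infMeanEnergyOn_pencil`,
`add_min_le_infMeanEnergyOn_pencil_of_le`, `abs_infMeanEnergyOn_pencil_sub_le`
(`HubbardTTPrimeTPPFillingTransport` §2); `FermionInteraction.tiGroundEnergyDensityAt_le_meanEnergy`,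
`le_tiGroundEnergyDensityAt`, `exists_isTranslationInvariant_density_eq`,
`tiGroundEnergyDensityAt_hubbardTTPrime_eq_energyDensityTT'` (`TIGroundEnergyDensityCouplingFamilies`);
`exists_isTorusLimitOf_squareGroundStatesTT'_meanEnergy_eq` (`HubbardTTPrimeTorusLimitState`);
`IsTorusLimitOf.re_expect_docc_le_sq_half_density_of_groundState` (`HubbardTTPrimeCapCutDualRows`),
`IsTorusLimitOf.isTranslationInvariant`, `density_eq_of_rectN`, `mem_szSector_iff`;
`meanEnergy_hubbardTTPrime_onSite_nonneg`, `_onSite_eq_re_expect_docc` (`HubbardTTPrimeAnchorWordBoxTransport`);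
and §2–§3 of the companion file. `lean search 'tiGroundEnergyDensityAt.*V|nnRepulsion'`: nothing before
these two files (2026-08-27).

## References

* M. Schüler, M. Rösner, T. O. Wehling, A. I. Lichtenstein, M. I. Katsnelson, PRL 111 (2013) 036601,
  Eq. (1) (extended Hubbard Hamiltonian), Eq. (2) (Peierls–Feynman–Bogoliubov), Eq. (3) (`U⋆`).
  [cite: SchulerEtAl2013, Eq. (2)]
* E. G. C. P. van Loon, M. Schüler, M. I. Katsnelson, T. O. Wehling, PRB 94 (2016) 165141, §2
  (`Ũ = U − αV`, limits of the local mapping). [cite: vanLoonEtAl2016, §2 Eqs. (5)–(6)]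
* T. Koma, H. Tasaki, J. Stat. Phys. 76 (1994) 745, §1 (ground-state energies are concave in a linear
  coupling; the conjugate observable). [cite: KomaTasaki1994, §1]
* R. B. Griffiths, Phys. Rev. 152 (1966) 240, §II (one-sided derivatives bracket the conjugate variable).
  [cite: Griffiths1966, §II]
* R. B. Israel, *Convexity in the Theory of Lattice Gases* (1979), Thm. I.3.4. [cite: Israel1979, Thm. I.3.4]
* D. Ruelle, *Statistical Mechanics* (1969), §3.4. [cite: Ruelle1969, §3.4]
-/

noncomputable section

namespace Literature.MathematicalPhysics.QuantumLattice

open Matrix Finset HubbardWave0 Literature.Probability.LatticeModels ThermodynamicLimit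
open _root_.Filter
open scoped _root_.Topology ComplexOrder BigOperators

/-! ### The `V`-direction words for the fixed-filling density `e_ρ(t,t',U,V)` -/

section Words

variable (t t' : ℝ)

/-- **At `V = 0` the fixed-filling density of the extended model IS the certified `t–t'` energy density**:
`tiGroundEnergyDensityAt (Φ(t,t',U) + 0·Φ_1) 1 ρ = energyDensityTT' t t' U ρ` (`U ≥ 0`, `0 < ρ < 2`).
[cite: Ruelle1969, §3.4] -/
theorem tiGroundEnergyDensityAt_hubbardTT'V_zero {U : ℝ} (hU : 0 ≤ U) {ρ : ℝ} (hρ0 : 0 < ρ) (hρ2 : ρ < 2) :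
    (hubbardTT'VFermionInteraction t t' U 0).tiGroundEnergyDensityAt 1 ρ = energyDensityTT' t t' U ρ := by
  rw [hubbardTT'VFermionInteraction_zero]
  exact tiGroundEnergyDensityAt_hubbardTTPrime_eq_energyDensityTT' t t' hU hρ0 hρ2

/-- **The fixed-filling density is CONCAVE in `V`** (every `U`, every `ρ`): an infimum of functions affine
in `V`. [cite: Israel1979, Thm. I.3.4] -/
theorem concaveOn_tiGroundEnergyDensityAt_hubbardTT'V_V (U ρ : ℝ) :
    ConcaveOn ℝ Set.univ fun V : ℝ => (hubbardTT'VFermionInteraction t t' U V).tiGroundEnergyDensityAt 1 ρ :=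
  FermionInteraction.concaveOn_infMeanEnergyOn_pencil _ _ _ 1

/-- **The fixed-filling density is NON-DECREASING in `V`** (its conjugate density `W ≥ 0` on every
state): `V₁ ≤ V₂ ⇒ e_ρ(t,t',U,V₁) ≤ e_ρ(t,t',U,V₂)` (`0 < ρ < 2`, any `U`). [cite: Griffiths1966, §II] -/
theorem tiGroundEnergyDensityAt_hubbardTT'V_mono_V (U : ℝ) {ρ : ℝ} (hρ0 : 0 < ρ) (hρ2 : ρ < 2)
    {V₁ V₂ : ℝ} (hV : V₁ ≤ V₂) :
    (hubbardTT'VFermionInteraction t t' U V₁).tiGroundEnergyDensityAt 1 ρ ≤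
      (hubbardTT'VFermionInteraction t t' U V₂).tiGroundEnergyDensityAt 1 ρ := by
  obtain ⟨ω, hω, hρ⟩ := exists_isTranslationInvariant_density_eq hρ0 hρ2
  refine FermionInteraction.le_tiGroundEnergyDensityAt _ _ ⟨ω, hω, hρ⟩ fun σ hσ hσρ => ?_
  refine (FermionInteraction.tiGroundEnergyDensityAt_le_meanEnergy _ _ hσ hσρ).trans ?_
  rw [σ.meanEnergy_hubbardTT'V, σ.meanEnergy_hubbardTT'V]
  have hW := σ.meanEnergy_nnRepulsion_one_nonneg
  nlinarith

/-- **The fixed-filling density is NON-DECREASING in `U`** as well (its conjugate density `D ≥ 0`):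
`U₁ ≤ U₂ ⇒ e_ρ(t,t',U₁,V) ≤ e_ρ(t,t',U₂,V)`. [cite: Griffiths1966, §II] -/
theorem tiGroundEnergyDensityAt_hubbardTT'V_mono_U (V : ℝ) {ρ : ℝ} (hρ0 : 0 < ρ) (hρ2 : ρ < 2)
    {U₁ U₂ : ℝ} (hU : U₁ ≤ U₂) :
    (hubbardTT'VFermionInteraction t t' U₁ V).tiGroundEnergyDensityAt 1 ρ ≤
      (hubbardTT'VFermionInteraction t t' U₂ V).tiGroundEnergyDensityAt 1 ρ := by
  obtain ⟨ω, hω, hρ⟩ := exists_isTranslationInvariant_density_eq hρ0 hρ2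
  refine FermionInteraction.le_tiGroundEnergyDensityAt _ _ ⟨ω, hω, hρ⟩ fun σ hσ hσρ => ?_
  refine (FermionInteraction.tiGroundEnergyDensityAt_le_meanEnergy _ _ hσ hσρ).trans ?_
  rw [σ.meanEnergy_hubbardTT'V_affine_U t t' U₂ V U₁]
  have hD := σ.meanEnergy_hubbardTTPrime_onSite_nonneg
  nlinarith

/-! #### Floors: U-only floors hold for the `U–V` model -/

/-- **The U-only energy density floors the extended model**: `energyDensityTT' t t' U ρ ≤ e_ρ(t,t',U,V)`
for `V ≥ 0` (`U ≥ 0`, `0 < ρ < 2`) — the infinite-volume, fixed-filling face of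
`PFB.groundEnergy_loc_le_ext` (`V̂ ⪰ 0`). [cite: SchulerEtAl2013, Eq. (2)] -/
theorem energyDensityTT'_le_tiGroundEnergyDensityAt_hubbardTT'V {U : ℝ} (hU : 0 ≤ U) {ρ : ℝ}
    (hρ0 : 0 < ρ) (hρ2 : ρ < 2) {V : ℝ} (hV : 0 ≤ V) :
    energyDensityTT' t t' U ρ ≤ (hubbardTT'VFermionInteraction t t' U V).tiGroundEnergyDensityAt 1 ρ := by
  rw [← tiGroundEnergyDensityAt_hubbardTT'V_zero t t' hU hρ0 hρ2]
  exact tiGroundEnergyDensityAt_hubbardTT'V_mono_V t t' U hρ0 hρ2 hV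

/-- **FLOOR TRANSFER**: a certified floor `L ≤ energyDensityTT' t t' U ρ` of the U-only model is a floor
of the extended model at every `V ≥ 0`: `L ≤ e_ρ(t,t',U,V)`. [cite: SchulerEtAl2013, Eq. (2)] -/
theorem energyDensityTT'_floor_le_hubbardTT'V {U : ℝ} (hU : 0 ≤ U) {ρ : ℝ} (hρ0 : 0 < ρ) (hρ2 : ρ < 2)
    {L : ℝ} (hL : L ≤ energyDensityTT' t t' U ρ) {V : ℝ} (hV : 0 ≤ V) :
    L ≤ (hubbardTT'VFermionInteraction t t' U V).tiGroundEnergyDensityAt 1 ρ :=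
  hL.trans (energyDensityTT'_le_tiGroundEnergyDensityAt_hubbardTT'V t t' hU hρ0 hρ2 hV)

/-- **Signed floor for any sign of `V`** (attractive `V < 0` included): `L + min(0, 4ρV) ≤ e_ρ(t,t',U,V)`
from a U-only floor `L` and the class-wide bracket `0 ≤ W ≤ 4ρ`. [cite: Griffiths1966, §II] -/
theorem energyDensityTT'_floor_add_min_le_hubbardTT'V {U : ℝ} (hU : 0 ≤ U) {ρ : ℝ} (hρ0 : 0 < ρ)
    (hρ2 : ρ < 2) {L : ℝ} (hL : L ≤ energyDensityTT' t t' U ρ) (V : ℝ) :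
    L + min 0 (V * (4 * ρ)) ≤ (hubbardTT'VFermionInteraction t t' U V).tiGroundEnergyDensityAt 1 ρ := by
  obtain ⟨ω, hω, hρ⟩ := exists_isTranslationInvariant_density_eq hρ0 hρ2
  rw [← tiGroundEnergyDensityAt_hubbardTTPrime_eq_energyDensityTT' t t' hU hρ0 hρ2] at hL
  have h := FermionInteraction.add_min_le_infMeanEnergyOn_pencil_of_le _ _ 1
    (S := {ω : InfVolFermionState 2 | ω.IsTranslationInvariant ∧ ω.density = ρ}) ⟨ω, ⟨hω, hρ⟩⟩ hL
    (lo := 0) (hi := 4 * ρ) (fun σ hσ => by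
      have hb := hσ.1.meanEnergy_nnRepulsion_one_mem_Icc
      rw [hσ.2] at hb
      exact hb) V
  rwa [mul_zero] at h

/-! #### Caps: U-only cap + `V` × a nearest-neighbour word -/

/-- **CAP FROM ONE STATE** (the variational step): a translation-invariant `ω₀` of density `ρ` with
`e^{tt'U}(ω₀) ≤ u` and `W(ω₀) ≤ Whi` gives `e_ρ(t,t',U,V) ≤ u + V·Whi` for every `V ≥ 0`.
[cite: Griffiths1966, §II] -/
theorem tiGroundEnergyDensityAt_hubbardTT'V_le_of_state (U : ℝ) {ρ : ℝ} {ω₀ : InfVolFermionState 2}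
    (hω₀ : ω₀.IsTranslationInvariant) (hρ : ω₀.density = ρ) {u : ℝ}
    (hu : ω₀.meanEnergy (hubbardTTPrimeFermionInteraction t t' U) 1 ≤ u) {Whi : ℝ}
    (hW : ω₀.meanEnergy (nnRepulsionFermionInteraction 2 1) 1 ≤ Whi) {V : ℝ} (hV : 0 ≤ V) :
    (hubbardTT'VFermionInteraction t t' U V).tiGroundEnergyDensityAt 1 ρ ≤ u + V * Whi := by
  refine (FermionInteraction.tiGroundEnergyDensityAt_le_meanEnergy _ _ hω₀ hρ).trans ?_
  rw [ω₀.meanEnergy_hubbardTT'V]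
  have h := mul_le_mul_of_nonneg_left hW hV
  linarith

/-- **CAP = U-only energy + `V` × a NEAREST-NEIGHBOUR WORD.** If every torus-limit ground state `ω` at
`(t,t',U,ρ)` (torus limit along some `Ls → ∞` of unit `(rectN ρ (Ls j), S^z = 0)` sector ground states —
the hypothesis class of the certified rows) has nearest-neighbour density–density energy `W(ω) ≤ Whi`,
then for every `V ≥ 0`: `e_ρ(t,t',U,V) ≤ energyDensityTT' t t' U ρ + V·Whi` (`U ≥ 0`, `0 < ρ < 2`) — the
infinite-volume face of `PFB.groundEnergy_ext_mem_Icc` (such a ground state exists and attains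
`energyDensityTT'`). [cite: SchulerEtAl2013, Eq. (2)] -/
theorem hubbardTT'V_le_energyDensityTT'_add_of_nnWord {U : ℝ} (hU : 0 ≤ U) {ρ : ℝ} (hρ0 : 0 < ρ)
    (hρ2 : ρ < 2) {Whi : ℝ}
    (hW : ∀ (ω : InfVolFermionState 2) (Ls : ℕ → ℕ) (ψ : ∀ L, Fock (Orb (FermionTorus 2 L))),
      Tendsto Ls atTop atTop →
      (∀ j, IsGroundStateInSector (hubbardTorusTT' (Ls j) t t' U) (rectN ρ (Ls j)) 0 (ψ (Ls j))) →
      (∀ j, star (ψ (Ls j)) ⬝ᵥ ψ (Ls j) = 1) → ω.IsTorusLimitOf ψ Ls →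
      ω.meanEnergy (nnRepulsionFermionInteraction 2 1) 1 ≤ Whi)
    {V : ℝ} (hV : 0 ≤ V) :
    (hubbardTT'VFermionInteraction t t' U V).tiGroundEnergyDensityAt 1 ρ ≤ energyDensityTT' t t' U ρ + V * Whi := by
  obtain ⟨ψ, Ls, ω, hLs, hω, hti, -, h1, hψ, hdens, -, he⟩ :=
    exists_isTorusLimitOf_squareGroundStatesTT'_meanEnergy_eq t t' hU hρ0.le hρ2
  exact tiGroundEnergyDensityAt_hubbardTT'V_le_of_state t t' U hti hdens he.le (hW ω Ls ψ hLs hψ h1 hω) hV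

/-- **CAP, EXPLICIT-CORRELATOR EDITION**: the nearest-neighbour word stated as a certificate engine prints
it, `Σ_i Re ω(n_0 n_{e_i}) ≤ Whi` on the torus-limit ground states at `(t,t',U,ρ)` (dictionary
`IsTranslationInvariant.meanEnergy_nnRepulsion_one_eq_sum`), gives `e_ρ(t,t',U,V) ≤ e(t,t',U,ρ) + V·Whi`.
[cite: SchulerEtAl2013, Eq. (2)] -/
theorem hubbardTT'V_le_energyDensityTT'_add_of_nnCorrWord {U : ℝ} (hU : 0 ≤ U) {ρ : ℝ} (hρ0 : 0 < ρ)
    (hρ2 : ρ < 2) {Whi : ℝ}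
    (hW : ∀ (ω : InfVolFermionState 2) (Ls : ℕ → ℕ) (ψ : ∀ L, Fock (Orb (FermionTorus 2 L))),
      Tendsto Ls atTop atTop →
      (∀ j, IsGroundStateInSector (hubbardTorusTT' (Ls j) t t' U) (rectN ρ (Ls j)) 0 (ψ (Ls j))) →
      (∀ j, star (ψ (Ls j)) ⬝ᵥ ψ (Ls j) = 1) → ω.IsTorusLimitOf ψ Ls →
      ∑ i : Fin 2, (ω.expect {0, 0 + unitVec i}
        ((nAt 0 (mem_insert_self _ _) 0 + nAt 0 (mem_insert_self _ _) 1) *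
          (nAt (0 + unitVec i) (mem_insert_of_mem (mem_singleton_self _)) 0 +
            nAt (0 + unitVec i) (mem_insert_of_mem (mem_singleton_self _)) 1))).re ≤ Whi)
    {V : ℝ} (hV : 0 ≤ V) :
    (hubbardTT'VFermionInteraction t t' U V).tiGroundEnergyDensityAt 1 ρ ≤ energyDensityTT' t t' U ρ + V * Whi := by
  refine hubbardTT'V_le_energyDensityTT'_add_of_nnWord t t' hU hρ0 hρ2 (fun ω Ls ψ hLs hψ h1 hω => ?_) hV
  rw [hω.isTranslationInvariant.meanEnergy_nnRepulsion_one_eq_sum]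
  exact hW ω Ls ψ hLs hψ h1 hω

/-- **CAP, DOCC-WORD EDITION.** If every torus-limit ground state at `(t,t',U,ρ)` has double occupancy
`Re ω(n_{0↑}n_{0↓}) ≤ dhi` (a certified docc ceiling of the registry), then for every `V ≥ 0`:
`e_ρ(t,t',U,V) ≤ energyDensityTT' t t' U ρ + V · 2(ρ + 2·dhi)` (`W ≤ 2(ρ + 2D)` on `ℤ²`).
[cite: KomaTasaki1994, §1] -/
theorem hubbardTT'V_le_energyDensityTT'_add_of_doccWord {U : ℝ} (hU : 0 ≤ U) {ρ : ℝ} (hρ0 : 0 < ρ)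
    (hρ2 : ρ < 2) {dhi : ℝ}
    (hD : ∀ (ω : InfVolFermionState 2) (Ls : ℕ → ℕ) (ψ : ∀ L, Fock (Orb (FermionTorus 2 L))),
      Tendsto Ls atTop atTop →
      (∀ j, IsGroundStateInSector (hubbardTorusTT' (Ls j) t t' U) (rectN ρ (Ls j)) 0 (ψ (Ls j))) →
      (∀ j, star (ψ (Ls j)) ⬝ᵥ ψ (Ls j) = 1) → ω.IsTorusLimitOf ψ Ls →
      (ω.expect ({0} : Finset (Site 2))
        (nAt 0 (Finset.mem_singleton_self 0) 0 * nAt 0 (Finset.mem_singleton_self 0) 1)).re ≤ dhi)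
    {V : ℝ} (hV : 0 ≤ V) :
    (hubbardTT'VFermionInteraction t t' U V).tiGroundEnergyDensityAt 1 ρ ≤
      energyDensityTT' t t' U ρ + V * (2 * (ρ + 2 * dhi)) := by
  refine hubbardTT'V_le_energyDensityTT'_add_of_nnWord t t' hU hρ0 hρ2 (fun ω Ls ψ hLs hψ h1 hω => ?_) hV
  have hN : ∀ j, IsNParticle (rectN ρ (Ls j)) (ψ (Ls j)) := fun j =>
    ((mem_szSector_iff _ _ _).1 (hψ j).1).1
  have h := hω.isTranslationInvariant.meanEnergy_nnRepulsion_one_le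
  have hρ := hω.density_eq_of_rectN hLs hρ0.le hN h1
  have h2 : ((2 : ℕ) : ℝ) = 2 := by norm_num
  rw [h2, hρ] at h
  have hd := hD ω Ls ψ hLs hψ h1 hω
  nlinarith

/-- **CAP, KINEMATIC EDITION** (no word at all): for `U > 0`, `0 < ρ < 2` and every `V ≥ 0`,
`e_ρ(t,t',U,V) ≤ energyDensityTT' t t' U ρ + V·(2ρ + ρ²)` — every torus-limit ground state has
`D ≤ (ρ/2)²` (no more double occupancy than the free Fermi sea), so `W ≤ 2(ρ + 2(ρ/2)²) = 2ρ + ρ²`.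
[cite: KomaTasaki1994, §1] -/
theorem hubbardTT'V_le_energyDensityTT'_add_kinematic {U : ℝ} (hU : 0 < U) {ρ : ℝ} (hρ0 : 0 < ρ)
    (hρ2 : ρ < 2) {V : ℝ} (hV : 0 ≤ V) :
    (hubbardTT'VFermionInteraction t t' U V).tiGroundEnergyDensityAt 1 ρ ≤
      energyDensityTT' t t' U ρ + V * (2 * ρ + ρ ^ 2) := by
  have h := hubbardTT'V_le_energyDensityTT'_add_of_doccWord t t' hU.le hρ0 hρ2 (dhi := (ρ / 2) ^ 2)
    (fun ω Ls ψ hLs hψ h1 hω => hω.re_expect_docc_le_sq_half_density_of_groundState t t' hU hρ0.le hρ2 hLs hψ h1)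
    hV
  have e : 2 * (ρ + 2 * (ρ / 2) ^ 2) = 2 * ρ + ρ ^ 2 := by ring
  rwa [e] at h

/-- **Cap under a certified U-only cap**: `energyDensityTT' t t' U ρ ≤ R` and the nearest-neighbour word
`W ≤ Whi` on the torus-limit ground states at `(t,t',U,ρ)` give `e_ρ(t,t',U,V) ≤ R + V·Whi` (`V ≥ 0`).
[cite: SchulerEtAl2013, Eq. (2)] -/
theorem hubbardTT'V_le_cap_add_of_nnWord {U : ℝ} (hU : 0 ≤ U) {ρ : ℝ} (hρ0 : 0 < ρ) (hρ2 : ρ < 2)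
    {R : ℝ} (hR : energyDensityTT' t t' U ρ ≤ R) {Whi : ℝ}
    (hW : ∀ (ω : InfVolFermionState 2) (Ls : ℕ → ℕ) (ψ : ∀ L, Fock (Orb (FermionTorus 2 L))),
      Tendsto Ls atTop atTop →
      (∀ j, IsGroundStateInSector (hubbardTorusTT' (Ls j) t t' U) (rectN ρ (Ls j)) 0 (ψ (Ls j))) →
      (∀ j, star (ψ (Ls j)) ⬝ᵥ ψ (Ls j) = 1) → ω.IsTorusLimitOf ψ Ls →
      ω.meanEnergy (nnRepulsionFermionInteraction 2 1) 1 ≤ Whi)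
    {V : ℝ} (hV : 0 ≤ V) :
    (hubbardTT'VFermionInteraction t t' U V).tiGroundEnergyDensityAt 1 ρ ≤ R + V * Whi :=
  (hubbardTT'V_le_energyDensityTT'_add_of_nnWord t t' hU hρ0 hρ2 hW hV).trans (by linarith)

/-- **Cap under a certified U-only cap, docc-word edition**: `energyDensityTT' t t' U ρ ≤ R` and
`D ≤ dhi` on the torus-limit ground states give `e_ρ(t,t',U,V) ≤ R + V·2(ρ + 2dhi)` (`V ≥ 0`).
[cite: KomaTasaki1994, §1] -/
theorem hubbardTT'V_le_cap_add_of_doccWord {U : ℝ} (hU : 0 ≤ U) {ρ : ℝ} (hρ0 : 0 < ρ) (hρ2 : ρ < 2)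
    {R : ℝ} (hR : energyDensityTT' t t' U ρ ≤ R) {dhi : ℝ}
    (hD : ∀ (ω : InfVolFermionState 2) (Ls : ℕ → ℕ) (ψ : ∀ L, Fock (Orb (FermionTorus 2 L))),
      Tendsto Ls atTop atTop →
      (∀ j, IsGroundStateInSector (hubbardTorusTT' (Ls j) t t' U) (rectN ρ (Ls j)) 0 (ψ (Ls j))) →
      (∀ j, star (ψ (Ls j)) ⬝ᵥ ψ (Ls j) = 1) → ω.IsTorusLimitOf ψ Ls →
      (ω.expect ({0} : Finset (Site 2))
        (nAt 0 (Finset.mem_singleton_self 0) 0 * nAt 0 (Finset.mem_singleton_self 0) 1)).re ≤ dhi)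
    {V : ℝ} (hV : 0 ≤ V) :
    (hubbardTT'VFermionInteraction t t' U V).tiGroundEnergyDensityAt 1 ρ ≤ R + V * (2 * (ρ + 2 * dhi)) :=
  (hubbardTT'V_le_energyDensityTT'_add_of_doccWord t t' hU hρ0 hρ2 hD hV).trans (by linarith)

/-- **Cap under a certified U-only cap, kinematic edition** (`U > 0`): `e_ρ(t,t',U,V) ≤ R + V·(2ρ + ρ²)`.
[cite: KomaTasaki1994, §1] -/
theorem hubbardTT'V_le_cap_add_kinematic {U : ℝ} (hU : 0 < U) {ρ : ℝ} (hρ0 : 0 < ρ) (hρ2 : ρ < 2)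
    {R : ℝ} (hR : energyDensityTT' t t' U ρ ≤ R) {V : ℝ} (hV : 0 ≤ V) :
    (hubbardTT'VFermionInteraction t t' U V).tiGroundEnergyDensityAt 1 ρ ≤ R + V * (2 * ρ + ρ ^ 2) :=
  (hubbardTT'V_le_energyDensityTT'_add_kinematic t t' hU hρ0 hρ2 hV).trans (by linarith)

/-! #### Two-sided windows and the `(U,V)`-box edition -/

/-- **THE TWO-SIDED `V`-WINDOW FROM U-ONLY DATA** (the fixed-filling face of `PFB.groundEnergy_ext_mem_Icc`):
a U-only floor `L ≤ energyDensityTT' t t' U ρ`, a U-only cap `energyDensityTT' t t' U ρ ≤ R` and a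
nearest-neighbour word `W ≤ Whi` on the torus-limit ground states at `(t,t',U,ρ)` give, for every `V ≥ 0`,
`e_ρ(t,t',U,V) ∈ [L, R + V·Whi]`. HONEST WIDTH: `R − L + V·Whi`; with `Whi` at the Hartree level `2ρ²`
and `V = 1.6`, `ρ = 0.85` the `V`-term alone is `≈ 2.3` (units of `t`). [cite: SchulerEtAl2013, Eq. (2)] -/
theorem tiGroundEnergyDensityAt_hubbardTT'V_mem_Icc_of_nnWord {U : ℝ} (hU : 0 ≤ U) {ρ : ℝ} (hρ0 : 0 < ρ)
    (hρ2 : ρ < 2) {L R : ℝ} (hL : L ≤ energyDensityTT' t t' U ρ) (hR : energyDensityTT' t t' U ρ ≤ R)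
    {Whi : ℝ}
    (hW : ∀ (ω : InfVolFermionState 2) (Ls : ℕ → ℕ) (ψ : ∀ L, Fock (Orb (FermionTorus 2 L))),
      Tendsto Ls atTop atTop →
      (∀ j, IsGroundStateInSector (hubbardTorusTT' (Ls j) t t' U) (rectN ρ (Ls j)) 0 (ψ (Ls j))) →
      (∀ j, star (ψ (Ls j)) ⬝ᵥ ψ (Ls j) = 1) → ω.IsTorusLimitOf ψ Ls →
      ω.meanEnergy (nnRepulsionFermionInteraction 2 1) 1 ≤ Whi)
    {V : ℝ} (hV : 0 ≤ V) :
    (hubbardTT'VFermionInteraction t t' U V).tiGroundEnergyDensityAt 1 ρ ∈ Set.Icc L (R + V * Whi) :=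
  ⟨energyDensityTT'_floor_le_hubbardTT'V t t' hU hρ0 hρ2 hL hV,
    hubbardTT'V_le_cap_add_of_nnWord t t' hU hρ0 hρ2 hR hW hV⟩

/-- **Two-sided `V`-window, docc-word edition**: `e_ρ(t,t',U,V) ∈ [L, R + V·2(ρ + 2dhi)]`.
[cite: KomaTasaki1994, §1] -/
theorem tiGroundEnergyDensityAt_hubbardTT'V_mem_Icc_of_doccWord {U : ℝ} (hU : 0 ≤ U) {ρ : ℝ}
    (hρ0 : 0 < ρ) (hρ2 : ρ < 2) {L R : ℝ} (hL : L ≤ energyDensityTT' t t' U ρ)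
    (hR : energyDensityTT' t t' U ρ ≤ R) {dhi : ℝ}
    (hD : ∀ (ω : InfVolFermionState 2) (Ls : ℕ → ℕ) (ψ : ∀ L, Fock (Orb (FermionTorus 2 L))),
      Tendsto Ls atTop atTop →
      (∀ j, IsGroundStateInSector (hubbardTorusTT' (Ls j) t t' U) (rectN ρ (Ls j)) 0 (ψ (Ls j))) →
      (∀ j, star (ψ (Ls j)) ⬝ᵥ ψ (Ls j) = 1) → ω.IsTorusLimitOf ψ Ls →
      (ω.expect ({0} : Finset (Site 2))
        (nAt 0 (Finset.mem_singleton_self 0) 0 * nAt 0 (Finset.mem_singleton_self 0) 1)).re ≤ dhi)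
    {V : ℝ} (hV : 0 ≤ V) :
    (hubbardTT'VFermionInteraction t t' U V).tiGroundEnergyDensityAt 1 ρ ∈
      Set.Icc L (R + V * (2 * (ρ + 2 * dhi))) :=
  ⟨energyDensityTT'_floor_le_hubbardTT'V t t' hU hρ0 hρ2 hL hV,
    hubbardTT'V_le_cap_add_of_doccWord t t' hU hρ0 hρ2 hR hD hV⟩

/-- **Two-sided `V`-window, kinematic edition** (`U > 0`): `e_ρ(t,t',U,V) ∈ [L, R + V·(2ρ + ρ²)]`.
[cite: KomaTasaki1994, §1] -/
theorem tiGroundEnergyDensityAt_hubbardTT'V_mem_Icc_kinematic {U : ℝ} (hU : 0 < U) {ρ : ℝ} (hρ0 : 0 < ρ)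
    (hρ2 : ρ < 2) {L R : ℝ} (hL : L ≤ energyDensityTT' t t' U ρ) (hR : energyDensityTT' t t' U ρ ≤ R)
    {V : ℝ} (hV : 0 ≤ V) :
    (hubbardTT'VFermionInteraction t t' U V).tiGroundEnergyDensityAt 1 ρ ∈ Set.Icc L (R + V * (2 * ρ + ρ ^ 2)) :=
  ⟨energyDensityTT'_floor_le_hubbardTT'V t t' hU.le hρ0 hρ2 hL hV,
    hubbardTT'V_le_cap_add_kinematic t t' hU hρ0 hρ2 hR hV⟩

/-- **THE `(U,V)`-BOX EDITION** (the shape a box engine consumes: ONE statement for the whole cell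
`[U₁,U₂] × [V₁,V₂]`, `0 ≤ U₁`, `0 ≤ V₁`). A U-only floor at the LEFT `U`-end, `L ≤ e(t,t',U₁,ρ)`, a U-only
cap at the RIGHT `U`-end, `e(t,t',U₂,ρ) ≤ R`, and a nearest-neighbour word `W ≤ Whi` (`0 ≤ Whi`) on the
torus-limit ground states at the right end `(t,t',U₂,ρ)` give, for every `(U,V)` in the cell,
`e_ρ(t,t',U,V) ∈ [L, R + V₂·Whi]` (`e_ρ` is non-decreasing in `U` and in `V`). [cite: Griffiths1966, §II] -/
theorem tiGroundEnergyDensityAt_hubbardTT'V_mem_Icc_on_box {ρ : ℝ} (hρ0 : 0 < ρ) (hρ2 : ρ < 2)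
    {U₁ U₂ V₁ V₂ : ℝ} (hU₁ : 0 ≤ U₁) (hV₁ : 0 ≤ V₁) {L R : ℝ} (hL : L ≤ energyDensityTT' t t' U₁ ρ)
    (hR : energyDensityTT' t t' U₂ ρ ≤ R) {Whi : ℝ} (hWhi : 0 ≤ Whi)
    (hW : ∀ (ω : InfVolFermionState 2) (Ls : ℕ → ℕ) (ψ : ∀ L, Fock (Orb (FermionTorus 2 L))),
      Tendsto Ls atTop atTop →
      (∀ j, IsGroundStateInSector (hubbardTorusTT' (Ls j) t t' U₂) (rectN ρ (Ls j)) 0 (ψ (Ls j))) →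
      (∀ j, star (ψ (Ls j)) ⬝ᵥ ψ (Ls j) = 1) → ω.IsTorusLimitOf ψ Ls →
      ω.meanEnergy (nnRepulsionFermionInteraction 2 1) 1 ≤ Whi)
    {U V : ℝ} (hU : U ∈ Set.Icc U₁ U₂) (hV : V ∈ Set.Icc V₁ V₂) :
    (hubbardTT'VFermionInteraction t t' U V).tiGroundEnergyDensityAt 1 ρ ∈ Set.Icc L (R + V₂ * Whi) := by
  have hV0 : 0 ≤ V := hV₁.trans hV.1
  have hU₂ : 0 ≤ U₂ := hU₁.trans (hU.1.trans hU.2)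
  refine ⟨?_, ?_⟩
  · exact (energyDensityTT'_floor_le_hubbardTT'V t t' hU₁ hρ0 hρ2 hL hV0).trans
      (tiGroundEnergyDensityAt_hubbardTT'V_mono_U t t' V hρ0 hρ2 hU.1)
  · refine (tiGroundEnergyDensityAt_hubbardTT'V_mono_U t t' V hρ0 hρ2 hU.2).trans ?_
    refine (hubbardTT'V_le_cap_add_of_nnWord t t' hU₂ hρ0 hρ2 hR hW hV0).trans ?_
    have h := mul_le_mul_of_nonneg_right hV.2 hWhi
    linarith

/-- **`(U,V)`-box edition with a docc word at the right `U`-end** (`0 ≤ dhi`):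
`e_ρ(t,t',U,V) ∈ [L, R + V₂·2(ρ + 2dhi)]` on `[U₁,U₂] × [V₁,V₂]`. [cite: Griffiths1966, §II] -/
theorem tiGroundEnergyDensityAt_hubbardTT'V_mem_Icc_on_box_of_doccWord {ρ : ℝ} (hρ0 : 0 < ρ) (hρ2 : ρ < 2)
    {U₁ U₂ V₁ V₂ : ℝ} (hU₁ : 0 ≤ U₁) (hV₁ : 0 ≤ V₁) {L R : ℝ} (hL : L ≤ energyDensityTT' t t' U₁ ρ)
    (hR : energyDensityTT' t t' U₂ ρ ≤ R) {dhi : ℝ} (hdhi : 0 ≤ dhi)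
    (hD : ∀ (ω : InfVolFermionState 2) (Ls : ℕ → ℕ) (ψ : ∀ L, Fock (Orb (FermionTorus 2 L))),
      Tendsto Ls atTop atTop →
      (∀ j, IsGroundStateInSector (hubbardTorusTT' (Ls j) t t' U₂) (rectN ρ (Ls j)) 0 (ψ (Ls j))) →
      (∀ j, star (ψ (Ls j)) ⬝ᵥ ψ (Ls j) = 1) → ω.IsTorusLimitOf ψ Ls →
      (ω.expect ({0} : Finset (Site 2))
        (nAt 0 (Finset.mem_singleton_self 0) 0 * nAt 0 (Finset.mem_singleton_self 0) 1)).re ≤ dhi)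
    {U V : ℝ} (hU : U ∈ Set.Icc U₁ U₂) (hV : V ∈ Set.Icc V₁ V₂) :
    (hubbardTT'VFermionInteraction t t' U V).tiGroundEnergyDensityAt 1 ρ ∈
      Set.Icc L (R + V₂ * (2 * (ρ + 2 * dhi))) := by
  have hV0 : 0 ≤ V := hV₁.trans hV.1
  have hU₂ : 0 ≤ U₂ := hU₁.trans (hU.1.trans hU.2)
  refine ⟨?_, ?_⟩
  · exact (energyDensityTT'_floor_le_hubbardTT'V t t' hU₁ hρ0 hρ2 hL hV0).trans
      (tiGroundEnergyDensityAt_hubbardTT'V_mono_U t t' V hρ0 hρ2 hU.1)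
  · refine (tiGroundEnergyDensityAt_hubbardTT'V_mono_U t t' V hρ0 hρ2 hU.2).trans ?_
    refine (hubbardTT'V_le_cap_add_of_doccWord t t' hU₂ hρ0 hρ2 hR hD hV0).trans ?_
    have hc : 0 ≤ 2 * (ρ + 2 * dhi) := by nlinarith
    have h := mul_le_mul_of_nonneg_right hV.2 hc
    linarith

/-- **`(U,V)`-box edition, kinematic** (`0 < U₁`): `e_ρ(t,t',U,V) ∈ [L, R + V₂·(2ρ + ρ²)]` on
`[U₁,U₂] × [V₁,V₂]` from the two U-only endpoint numbers alone. [cite: Griffiths1966, §II] -/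
theorem tiGroundEnergyDensityAt_hubbardTT'V_mem_Icc_on_box_kinematic {ρ : ℝ} (hρ0 : 0 < ρ) (hρ2 : ρ < 2)
    {U₁ U₂ V₁ V₂ : ℝ} (hU₁ : 0 < U₁) (hV₁ : 0 ≤ V₁) {L R : ℝ} (hL : L ≤ energyDensityTT' t t' U₁ ρ)
    (hR : energyDensityTT' t t' U₂ ρ ≤ R) {U V : ℝ} (hU : U ∈ Set.Icc U₁ U₂) (hV : V ∈ Set.Icc V₁ V₂) :
    (hubbardTT'VFermionInteraction t t' U V).tiGroundEnergyDensityAt 1 ρ ∈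
      Set.Icc L (R + V₂ * (2 * ρ + ρ ^ 2)) := by
  have hV0 : 0 ≤ V := hV₁.trans hV.1
  have hU₂ : 0 < U₂ := hU₁.trans_le (hU.1.trans hU.2)
  refine ⟨?_, ?_⟩
  · exact (energyDensityTT'_floor_le_hubbardTT'V t t' hU₁.le hρ0 hρ2 hL hV0).trans
      (tiGroundEnergyDensityAt_hubbardTT'V_mono_U t t' V hρ0 hρ2 hU.1)
  · refine (tiGroundEnergyDensityAt_hubbardTT'V_mono_U t t' V hρ0 hρ2 hU.2).trans ?_
    refine (hubbardTT'V_le_cap_add_kinematic t t' hU₂ hρ0 hρ2 hR hV0).trans ?_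
    have hc : 0 ≤ 2 * ρ + ρ ^ 2 := by positivity
    have h := mul_le_mul_of_nonneg_right hV.2 hc
    linarith

/-! #### The joint tangent plane at a U-only anchor `(Ũ, 0)` (Schüler's functional per site) -/

/-- **JOINT `(U,V)` TANGENT PLANE AT A U-ONLY ANCHOR `(Ũ, 0)`** — the per-site, fixed-filling form of
`PFB.groundEnergy_ext_le` / Schüler's functional `Φ̃(Ũ) = E₀(K(Ũ)) + (U − Ũ)⟨D⟩_Ũ + ⟨V̂⟩_Ũ`: if every
torus-limit ground state at `(t,t',Ũ,ρ)` has `dlo ≤ D ≤ dhi` and `W ≤ Whi`, then for EVERY `U` and every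
`V ≥ 0`, `e_ρ(t,t',U,V) ≤ e(t,t',Ũ,ρ) + max((U−Ũ)·dlo, (U−Ũ)·dhi) + V·Whi` (`Ũ ≥ 0`, `0 < ρ < 2`): the local
model at ANY `Ũ` — in particular at Schüler's `U⋆ < U` — caps the extended model; no choice of `Ũ` floors it
beyond `e(t,t',U,ρ)`. [cite: SchulerEtAl2013, Eq. (2)–(3)] -/
theorem hubbardTT'V_le_anchor_tangentPlane {Ua : ℝ} (hUa : 0 ≤ Ua) {ρ : ℝ} (hρ0 : 0 < ρ) (hρ2 : ρ < 2)
    {dlo dhi Whi : ℝ}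
    (hD : ∀ (ω : InfVolFermionState 2) (Ls : ℕ → ℕ) (ψ : ∀ L, Fock (Orb (FermionTorus 2 L))),
      Tendsto Ls atTop atTop →
      (∀ j, IsGroundStateInSector (hubbardTorusTT' (Ls j) t t' Ua) (rectN ρ (Ls j)) 0 (ψ (Ls j))) →
      (∀ j, star (ψ (Ls j)) ⬝ᵥ ψ (Ls j) = 1) → ω.IsTorusLimitOf ψ Ls →
      dlo ≤ (ω.expect ({0} : Finset (Site 2))
        (nAt 0 (Finset.mem_singleton_self 0) 0 * nAt 0 (Finset.mem_singleton_self 0) 1)).re ∧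
      (ω.expect ({0} : Finset (Site 2))
        (nAt 0 (Finset.mem_singleton_self 0) 0 * nAt 0 (Finset.mem_singleton_self 0) 1)).re ≤ dhi ∧
      ω.meanEnergy (nnRepulsionFermionInteraction 2 1) 1 ≤ Whi)
    (U : ℝ) {V : ℝ} (hV : 0 ≤ V) :
    (hubbardTT'VFermionInteraction t t' U V).tiGroundEnergyDensityAt 1 ρ ≤
      energyDensityTT' t t' Ua ρ + max ((U - Ua) * dlo) ((U - Ua) * dhi) + V * Whi := by
  obtain ⟨ψ, Ls, ω, hLs, hω, hti, -, h1, hψ, hdens, -, he⟩ :=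
    exists_isTorusLimitOf_squareGroundStatesTT'_meanEnergy_eq t t' hUa hρ0.le hρ2
  obtain ⟨hlo, hhi, hW⟩ := hD ω Ls ψ hLs hψ h1 hω
  refine (FermionInteraction.tiGroundEnergyDensityAt_le_meanEnergy _ _ hti hdens).trans ?_
  rw [ω.meanEnergy_hubbardTT'V_affine_U t t' U V Ua, ω.meanEnergy_hubbardTT'V,
    ω.meanEnergy_hubbardTTPrime_onSite_eq_re_expect_docc, he]
  have hWV := mul_le_mul_of_nonneg_left hW hV
  have hslope : (U - Ua) * (ω.expect ({0} : Finset (Site 2))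
      (nAt 0 (Finset.mem_singleton_self 0) 0 * nAt 0 (Finset.mem_singleton_self 0) 1)).re ≤
      max ((U - Ua) * dlo) ((U - Ua) * dhi) := by
    rcases le_total 0 (U - Ua) with hs | hs
    · exact (mul_le_mul_of_nonneg_left hhi hs).trans (le_max_right _ _)
    · exact (mul_le_mul_of_nonpos_left hlo hs).trans (le_max_left _ _)
  linarith

/-! #### Increments and Lipschitz continuity in `V` -/

/-- **Lipschitz continuity in `V` at fixed filling** (any `U`, `0 < ρ < 2`):
`|e_ρ(t,t',U,V) − e_ρ(t,t',U,V')| ≤ 4ρ·|V − V'|` — the class-wide bracket `0 ≤ W ≤ 4ρ`.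
[cite: Israel1979, Thm. I.3.4] -/
theorem abs_tiGroundEnergyDensityAt_hubbardTT'V_sub_le (U : ℝ) {ρ : ℝ} (hρ0 : 0 < ρ) (hρ2 : ρ < 2)
    (V V' : ℝ) :
    |(hubbardTT'VFermionInteraction t t' U V).tiGroundEnergyDensityAt 1 ρ -
        (hubbardTT'VFermionInteraction t t' U V').tiGroundEnergyDensityAt 1 ρ| ≤ 4 * ρ * |V - V'| := by
  obtain ⟨ω, hω, hρ⟩ := exists_isTranslationInvariant_density_eq hρ0 hρ2
  refine FermionInteraction.abs_infMeanEnergyOn_pencil_sub_le _ _ 1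
    (S := {ω : InfVolFermionState 2 | ω.IsTranslationInvariant ∧ ω.density = ρ}) ⟨ω, ⟨hω, hρ⟩⟩
    (fun σ hσ => ?_) V V'
  have hb := hσ.1.meanEnergy_nnRepulsion_one_mem_Icc
  rw [hσ.2] at hb
  exact abs_le.2 ⟨by linarith [hb.1, hρ0], hb.2⟩

/-- **The increment bracket**: for `V₁ ≤ V₂`, `0 ≤ e_ρ(t,t',U,V₂) − e_ρ(t,t',U,V₁) ≤ 4ρ(V₂ − V₁)`.
[cite: Griffiths1966, §II] -/
theorem tiGroundEnergyDensityAt_hubbardTT'V_sub_mem_Icc (U : ℝ) {ρ : ℝ} (hρ0 : 0 < ρ) (hρ2 : ρ < 2)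
    {V₁ V₂ : ℝ} (hV : V₁ ≤ V₂) :
    (hubbardTT'VFermionInteraction t t' U V₂).tiGroundEnergyDensityAt 1 ρ -
        (hubbardTT'VFermionInteraction t t' U V₁).tiGroundEnergyDensityAt 1 ρ ∈
      Set.Icc 0 (4 * ρ * (V₂ - V₁)) := by
  refine ⟨sub_nonneg.2 (tiGroundEnergyDensityAt_hubbardTT'V_mono_V t t' U hρ0 hρ2 hV), ?_⟩
  have h := abs_tiGroundEnergyDensityAt_hubbardTT'V_sub_le t t' U hρ0 hρ2 V₂ V₁
  rw [abs_of_nonneg (sub_nonneg.2 hV)] at h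
  exact (le_abs_self _).trans h

/-! #### (appended) Particle–hole floors: above half filling the `V`-increment is at least `8(ρ−1)·V` -/

/-- **FLOOR TRANSFER WITH THE PARTICLE–HOLE GAIN**: a certified U-only floor `L ≤ energyDensityTT' t t' U ρ`
gives, for every `V ≥ 0`, `L + V·max(0, 8(ρ − 1)) ≤ e_ρ(t,t',U,V)` (`U ≥ 0`, `0 < ρ < 2`): every
translation-invariant state of density `ρ` has `W ≥ max(0, 8(ρ−1))`
(`IsTranslationInvariant.meanEnergy_nnRepulsion_one_mem_Icc_max`) — on the electron-doped side `ρ > 1` the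
U-only floor is RAISED by `8(ρ−1)V` (e.g. `ρ = 1.15`, `V = 1.6t`: `+1.92t`). [cite: Griffiths1966, §II] -/
theorem energyDensityTT'_floor_add_mul_max_le_hubbardTT'V {U : ℝ} (hU : 0 ≤ U) {ρ : ℝ} (hρ0 : 0 < ρ)
    (hρ2 : ρ < 2) {L : ℝ} (hL : L ≤ energyDensityTT' t t' U ρ) {V : ℝ} (hV : 0 ≤ V) :
    L + V * max 0 (8 * (ρ - 1)) ≤ (hubbardTT'VFermionInteraction t t' U V).tiGroundEnergyDensityAt 1 ρ := by
  obtain ⟨ω, hω, hρ⟩ := exists_isTranslationInvariant_density_eq hρ0 hρ2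
  refine FermionInteraction.le_tiGroundEnergyDensityAt _ _ ⟨ω, hω, hρ⟩ fun σ hσ hσρ => ?_
  rw [σ.meanEnergy_hubbardTT'V]
  have he : energyDensityTT' t t' U ρ ≤ σ.meanEnergy (hubbardTTPrimeFermionInteraction t t' U) 1 := by
    rw [← tiGroundEnergyDensityAt_hubbardTTPrime_eq_energyDensityTT' t t' hU hρ0 hρ2]
    exact FermionInteraction.tiGroundEnergyDensityAt_le_meanEnergy _ _ hσ hσρ
  have hW := (hσ.meanEnergy_nnRepulsion_one_mem_Icc_max).1
  rw [hσρ] at hW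
  have h := mul_le_mul_of_nonneg_left hW hV
  linarith

/-- **Signed floor with both class brackets** (any sign of `V`):
`L + min(V·max(0, 8(ρ−1)), V·4ρ) ≤ e_ρ(t,t',U,V)`. [cite: Griffiths1966, §II] -/
theorem energyDensityTT'_floor_add_min_le_hubbardTT'V' {U : ℝ} (hU : 0 ≤ U) {ρ : ℝ} (hρ0 : 0 < ρ)
    (hρ2 : ρ < 2) {L : ℝ} (hL : L ≤ energyDensityTT' t t' U ρ) (V : ℝ) :
    L + min (V * max 0 (8 * (ρ - 1))) (V * (4 * ρ)) ≤
      (hubbardTT'VFermionInteraction t t' U V).tiGroundEnergyDensityAt 1 ρ := by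
  obtain ⟨ω, hω, hρ⟩ := exists_isTranslationInvariant_density_eq hρ0 hρ2
  rw [← tiGroundEnergyDensityAt_hubbardTTPrime_eq_energyDensityTT' t t' hU hρ0 hρ2] at hL
  exact FermionInteraction.add_min_le_infMeanEnergyOn_pencil_of_le _ _ 1
    (S := {ω : InfVolFermionState 2 | ω.IsTranslationInvariant ∧ ω.density = ρ}) ⟨ω, ⟨hω, hρ⟩⟩ hL
    (lo := max 0 (8 * (ρ - 1))) (hi := 4 * ρ) (fun σ hσ => by
      have hb := hσ.1.meanEnergy_nnRepulsion_one_mem_Icc_max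
      rw [hσ.2] at hb
      exact hb) V

/-- **Increment floor**: for `V₁ ≤ V₂`, `(V₂ − V₁)·max(0, 8(ρ−1)) ≤ e_ρ(t,t',U,V₂) − e_ρ(t,t',U,V₁)` (any `U`,
`0 < ρ < 2`) — the mirror of the increment cap `4ρ(V₂ − V₁)`. [cite: Griffiths1966, §II] -/
theorem mul_max_le_tiGroundEnergyDensityAt_hubbardTT'V_sub (U : ℝ) {ρ : ℝ} (hρ0 : 0 < ρ) (hρ2 : ρ < 2)
    {V₁ V₂ : ℝ} (hV : V₁ ≤ V₂) :
    (V₂ - V₁) * max 0 (8 * (ρ - 1)) ≤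
      (hubbardTT'VFermionInteraction t t' U V₂).tiGroundEnergyDensityAt 1 ρ -
        (hubbardTT'VFermionInteraction t t' U V₁).tiGroundEnergyDensityAt 1 ρ := by
  obtain ⟨ω, hω, hρ⟩ := exists_isTranslationInvariant_density_eq hρ0 hρ2
  rw [le_sub_iff_add_le']
  refine FermionInteraction.le_tiGroundEnergyDensityAt _ _ ⟨ω, hω, hρ⟩ fun σ hσ hσρ => ?_
  have h1 := FermionInteraction.tiGroundEnergyDensityAt_le_meanEnergy (hubbardTT'VFermionInteraction t t' U V₁) 1
    hσ hσρ
  rw [σ.meanEnergy_hubbardTT'V] at h1 ⊢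
  have hW := (hσ.meanEnergy_nnRepulsion_one_mem_Icc_max).1
  rw [hσρ] at hW
  have h := mul_le_mul_of_nonneg_left hW (sub_nonneg.2 hV)
  linarith

/-- **`(U,V)`-box edition with the particle–hole floor**: on `[U₁,U₂] × [V₁,V₂]` (`0 ≤ U₁`, `0 ≤ V₁`), a
U-only floor `L` at the left `U`-end, a U-only cap `R` at the right `U`-end and a nearest-neighbour word
`W ≤ Whi` (`0 ≤ Whi`) on the torus-limit ground states at the right end give
`e_ρ(t,t',U,V) ∈ [L + V₁·max(0, 8(ρ−1)), R + V₂·Whi]`. [cite: Griffiths1966, §II] -/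
theorem tiGroundEnergyDensityAt_hubbardTT'V_mem_Icc_on_box_particleHole {ρ : ℝ} (hρ0 : 0 < ρ) (hρ2 : ρ < 2)
    {U₁ U₂ V₁ V₂ : ℝ} (hU₁ : 0 ≤ U₁) (hV₁ : 0 ≤ V₁) {L R : ℝ} (hL : L ≤ energyDensityTT' t t' U₁ ρ)
    (hR : energyDensityTT' t t' U₂ ρ ≤ R) {Whi : ℝ} (hWhi : 0 ≤ Whi)
    (hW : ∀ (ω : InfVolFermionState 2) (Ls : ℕ → ℕ) (ψ : ∀ L, Fock (Orb (FermionTorus 2 L))),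
      Tendsto Ls atTop atTop →
      (∀ j, IsGroundStateInSector (hubbardTorusTT' (Ls j) t t' U₂) (rectN ρ (Ls j)) 0 (ψ (Ls j))) →
      (∀ j, star (ψ (Ls j)) ⬝ᵥ ψ (Ls j) = 1) → ω.IsTorusLimitOf ψ Ls →
      ω.meanEnergy (nnRepulsionFermionInteraction 2 1) 1 ≤ Whi)
    {U V : ℝ} (hU : U ∈ Set.Icc U₁ U₂) (hV : V ∈ Set.Icc V₁ V₂) :
    (hubbardTT'VFermionInteraction t t' U V).tiGroundEnergyDensityAt 1 ρ ∈
      Set.Icc (L + V₁ * max 0 (8 * (ρ - 1))) (R + V₂ * Whi) := by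
  have hV0 : 0 ≤ V := hV₁.trans hV.1
  refine ⟨?_, (tiGroundEnergyDensityAt_hubbardTT'V_mem_Icc_on_box t t' hρ0 hρ2 hU₁ hV₁ hL hR hWhi hW hU hV).2⟩
  have hm : V₁ * max 0 (8 * (ρ - 1)) ≤ V * max 0 (8 * (ρ - 1)) :=
    mul_le_mul_of_nonneg_right hV.1 (le_max_left _ _)
  exact (by linarith : L + V₁ * max 0 (8 * (ρ - 1)) ≤ L + V * max 0 (8 * (ρ - 1))).trans
    ((energyDensityTT'_floor_add_mul_max_le_hubbardTT'V t t' hU₁ hρ0 hρ2 hL hV0).trans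
      (tiGroundEnergyDensityAt_hubbardTT'V_mono_U t t' V hρ0 hρ2 hU.1))

/-! #### (appended) The nearest-neighbour word in WINDOW form (one region, as a certificate reader prints it) -/

/-- **DICTIONARY, window form** (general `d`): for translation-invariant `ω` and any region `Λ'` containing
the origin and its `d` forward neighbours, `W(ω) = Re ω_{Λ'}(Σ_i n_0 n_{e_i})` — the conjugate density as
the expectation of ONE local observable of ONE region (the objective of a window certificate, e.g.
`Λ' = thicken {0} R`). [cite: BratteliKishimotoRobinson1978, §3 (mean energy functional)] -/
theorem InfVolFermionState.IsTranslationInvariant.meanEnergy_nnRepulsion_one_eq_re_expect_window {d : ℕ}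
    {ω : InfVolFermionState d} (hω : ω.IsTranslationInvariant) {Λ' : Finset (Site d)}
    (h0 : (0 : Site d) ∈ Λ') (he : ∀ i : Fin d, 0 + unitVec i ∈ Λ') :
    ω.meanEnergy (nnRepulsionFermionInteraction d 1) 1 =
      (ω.expect Λ' (∑ i : Fin d, (nAt 0 h0 0 + nAt 0 h0 1) *
        (nAt (0 + unitVec i) (he i) 0 + nAt (0 + unitVec i) (he i) 1))).re := by
  rw [hω.meanEnergy_nnRepulsion_one_eq_sum, map_sum, Complex.re_sum]
  refine Finset.sum_congr rfl fun i _ => ?_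
  have hsub : ({0, 0 + unitVec i} : Finset (Site d)) ⊆ Λ' := insert_subset h0 (singleton_subset_iff.2 (he i))
  rw [← ω.compatible hsub]
  simp only [nAt, map_mul, map_add, fermionEmbed_numberOp, PolySite.incl_pt]

/-- **CAP FROM A WINDOW-CERTIFIED NEAREST-NEIGHBOUR WORD**: if every torus-limit ground state at `(t,t',U,ρ)`
has `Re ω_{Λ'}(Σ_i n_0 n_{e_i}) ≤ Whi` for some fixed region `Λ' ∋ 0, e₁, e₂` (the shape delivered by a
window-certificate soundness theorem with objective `−Σ_i n_0 n_{e_i}`), then for every `V ≥ 0`: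
`e_ρ(t,t',U,V) ≤ energyDensityTT' t t' U ρ + V·Whi`. [cite: SchulerEtAl2013, Eq. (2)] -/
theorem hubbardTT'V_le_energyDensityTT'_add_of_nnWindowWord {U : ℝ} (hU : 0 ≤ U) {ρ : ℝ} (hρ0 : 0 < ρ)
    (hρ2 : ρ < 2) {Λ' : Finset (Site 2)} (h0 : (0 : Site 2) ∈ Λ') (he : ∀ i : Fin 2, 0 + unitVec i ∈ Λ')
    {Whi : ℝ}
    (hW : ∀ (ω : InfVolFermionState 2) (Ls : ℕ → ℕ) (ψ : ∀ L, Fock (Orb (FermionTorus 2 L))),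
      Tendsto Ls atTop atTop →
      (∀ j, IsGroundStateInSector (hubbardTorusTT' (Ls j) t t' U) (rectN ρ (Ls j)) 0 (ψ (Ls j))) →
      (∀ j, star (ψ (Ls j)) ⬝ᵥ ψ (Ls j) = 1) → ω.IsTorusLimitOf ψ Ls →
      (ω.expect Λ' (∑ i : Fin 2, (nAt 0 h0 0 + nAt 0 h0 1) *
        (nAt (0 + unitVec i) (he i) 0 + nAt (0 + unitVec i) (he i) 1))).re ≤ Whi)
    {V : ℝ} (hV : 0 ≤ V) :
    (hubbardTT'VFermionInteraction t t' U V).tiGroundEnergyDensityAt 1 ρ ≤ energyDensityTT' t t' U ρ + V * Whi := by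
  refine hubbardTT'V_le_energyDensityTT'_add_of_nnWord t t' hU hρ0 hρ2 (fun ω Ls ψ hLs hψ h1 hω => ?_) hV
  rw [hω.isTranslationInvariant.meanEnergy_nnRepulsion_one_eq_re_expect_window h0 he]
  exact hW ω Ls ψ hLs hψ h1 hω

/-- **`(U,V)`-box edition fed by a window-certified nearest-neighbour word at the right `U`-end**:
`e_ρ(t,t',U,V) ∈ [L + V₁·max(0, 8(ρ−1)), R + V₂·Whi]` on `[U₁,U₂] × [V₁,V₂]`. [cite: Griffiths1966, §II] -/
theorem tiGroundEnergyDensityAt_hubbardTT'V_mem_Icc_on_box_of_nnWindowWord {ρ : ℝ} (hρ0 : 0 < ρ)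
    (hρ2 : ρ < 2) {U₁ U₂ V₁ V₂ : ℝ} (hU₁ : 0 ≤ U₁) (hV₁ : 0 ≤ V₁) {L R : ℝ}
    (hL : L ≤ energyDensityTT' t t' U₁ ρ) (hR : energyDensityTT' t t' U₂ ρ ≤ R)
    {Λ' : Finset (Site 2)} (h0 : (0 : Site 2) ∈ Λ') (he : ∀ i : Fin 2, 0 + unitVec i ∈ Λ') {Whi : ℝ}
    (hWhi : 0 ≤ Whi)
    (hW : ∀ (ω : InfVolFermionState 2) (Ls : ℕ → ℕ) (ψ : ∀ L, Fock (Orb (FermionTorus 2 L))),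
      Tendsto Ls atTop atTop →
      (∀ j, IsGroundStateInSector (hubbardTorusTT' (Ls j) t t' U₂) (rectN ρ (Ls j)) 0 (ψ (Ls j))) →
      (∀ j, star (ψ (Ls j)) ⬝ᵥ ψ (Ls j) = 1) → ω.IsTorusLimitOf ψ Ls →
      (ω.expect Λ' (∑ i : Fin 2, (nAt 0 h0 0 + nAt 0 h0 1) *
        (nAt (0 + unitVec i) (he i) 0 + nAt (0 + unitVec i) (he i) 1))).re ≤ Whi)
    {U V : ℝ} (hU : U ∈ Set.Icc U₁ U₂) (hV : V ∈ Set.Icc V₁ V₂) :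
    (hubbardTT'VFermionInteraction t t' U V).tiGroundEnergyDensityAt 1 ρ ∈
      Set.Icc (L + V₁ * max 0 (8 * (ρ - 1))) (R + V₂ * Whi) :=
  tiGroundEnergyDensityAt_hubbardTT'V_mem_Icc_on_box_particleHole t t' hρ0 hρ2 hU₁ hV₁ hL hR hWhi
    (fun ω Ls ψ hLs hψ h1 hω => by
      rw [hω.isTranslationInvariant.meanEnergy_nnRepulsion_one_eq_re_expect_window h0 he]
      exact hW ω Ls ψ hLs hψ h1 hω) hU hV

end Words

end Literature.MathematicalPhysics.QuantumLattice

end
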